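import Literature.AlgebraicGeometry.Resolution.WeightedCentreSigmaRescaling
import HarnessLib

/-!
# LEMMA G: additive shifts off a set of slots form a group; the fixers of `G` a subgroup (instrument, NOT a resolution theorem)

Engine 1 of the RESOLUTION OBSERVATORY toy model `W(f)` (weighted-centre invariant in characteristic `p`; RE-DERIVATION-eng1-g41
§3.7 "the GROUP TRICK", LEMMA G; CARVER-NOTES-eng1-g41 T91) uses the "rigid" part of the isotropy group of the weighted centre:
for a set of slots `U ⊆ ι` and shift data `P : ι → k[ε][σ]` with `P_u = 0` for `u ∈ U` and every `P_x ∈ k[ε_U][σ]` (only slots of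
`U` occur), the substitution

  `Φ_P : ε_x ↦ ε_x + P_x (x ∉ U), ε_u ↦ ε_u (u ∈ U), σ ↦ σ, scalars fixed`

satisfies `Φ_P ∘ Φ_{P′} = Φ_{P+P′}` (because `Φ_P` fixes `k[ε_U][σ]` pointwise) and `Φ_0 = id`; hence
`{P : Φ_P fixes G}` is an ADDITIVE SUBGROUP of the shift data, and it is stable under the base change `σ ↦ μσ` because `G` is
`σ`-free.  This file types exactly that, in the frame of `WeightedCentreGradedIsotropy` / `WeightedCentreSigmaRescaling`
(`k[ε][σ] = (MvPolynomial ι k)[X]`, `σ = Polynomial.X`, `IsIsotropyOf G Φ :↔ Φ (C G) = C G`, `rescaleHom a Φ = Φ_{aσ}`):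

* `AdditiveShift.IsOver U F` — `F ∈ k[ε_U][σ]` (every `σ`-coefficient involves only slots of `U`); closure lemmas;
  `AdditiveShift.apply_eq_self_of_isOver` — an endomorphism fixing scalars, `σ` and the slots of `U` fixes `k[ε_U][σ]` pointwise;
* `AdditiveShift.IsShiftBy U P Φ` — `Φ` is the additive shift by `P` off `U`; `IsShiftBy.comp` (`P + P′`), `isShiftBy_id` (`P = 0`),
  `IsShiftBy.unique`, `IsShiftBy.eq_id`; the construction `AdditiveShift.shiftHom P` with `isShiftBy_shiftHom`, `shiftHom_add`,
  `shiftHom_zero`; gradedness `isGradedHom_shiftHom` when `P_x` has total weight `w x`;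
* `AdditiveShift.fixingShifts U G : AddSubgroup (ι → k[ε][σ])` — LEMMA G: the shift data over `U` whose shift fixes `G`;
* base change: `IsShiftBy.rescaleHom` (`(Φ_P)_{μσ} = Φ_{P(μσ)}`) and `AdditiveShift.rescale_mem_fixingShifts` — the subgroup is
  stable under `P ↦ P(μσ, ε)`.

No hypothesis `(P)`, no weights needed except in `isGradedHom_shiftHom`.  References: substitution endomorphisms / isotropies
[SerreLocalFields1979, Ch. II §4 Lemma 1] (pattern cite, as in `WeightedCentreSigmaRescaling`); the weighted frame
[AbramovichTemkinWlodarczyk2024, Thm. 5.3.1 (2)–(3) (p. 1578)].  All statements are OURS (toy-model bookkeeping).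
-/

namespace Literature.AlgebraicGeometry.Resolution.WeightedBlowup

open Polynomial

namespace AdditiveShift

variable {k : Type*} [CommRing k] {ι : Type*}

/-! ## `k[ε_U][σ]` as a predicate -/

/-- `F ∈ k[ε_U][σ]`: every `σ`-coefficient of `F` involves only slots of `U` (ours). [cite: SerreLocalFields1979, Ch. II §4 Lemma 1] -/
def IsOver (U : Set ι) (F : (MvPolynomial ι k)[X]) : Prop := ∀ s, ∀ j ∈ (F.coeff s).vars, j ∈ U

namespace IsOver

variable {U : Set ι}

/-- Bookkeeping (ours). [cite: SerreLocalFields1979, Ch. II §4 Lemma 1] -/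
theorem zero : IsOver U (0 : (MvPolynomial ι k)[X]) := fun s j hj => by
  rw [Polynomial.coeff_zero, MvPolynomial.vars_0] at hj
  exact absurd hj (Finset.notMem_empty j)

/-- Bookkeeping (ours). [cite: SerreLocalFields1979, Ch. II §4 Lemma 1] -/
theorem add [DecidableEq ι] {F G : (MvPolynomial ι k)[X]} (hF : IsOver U F) (hG : IsOver U G) : IsOver U (F + G) :=
  fun s j hj => by
    rw [Polynomial.coeff_add] at hj
    rcases Finset.mem_union.mp (MvPolynomial.vars_add_subset _ _ hj) with h | h
    · exact hF s j h
    · exact hG s j h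

/-- Bookkeeping (ours). [cite: SerreLocalFields1979, Ch. II §4 Lemma 1] -/
theorem neg {F : (MvPolynomial ι k)[X]} (hF : IsOver U F) : IsOver U (-F) := fun s j hj => by
  rw [Polynomial.coeff_neg, MvPolynomial.vars_neg] at hj
  exact hF s j hj

/-- Bookkeeping (ours). [cite: SerreLocalFields1979, Ch. II §4 Lemma 1] -/
theorem sub [DecidableEq ι] {F G : (MvPolynomial ι k)[X]} (hF : IsOver U F) (hG : IsOver U G) : IsOver U (F - G) := by
  rw [sub_eq_add_neg]; exact hF.add hG.neg

/-- Bookkeeping (ours): multiplying the coefficients by constants of `k[ε]` without slots keeps `F` over `U` — used for `σ ↦ μσ`.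
[cite: SerreLocalFields1979, Ch. II §4 Lemma 1] -/
theorem C_mul [DecidableEq ι] {F : (MvPolynomial ι k)[X]} (hF : IsOver U F) (c : k) :
    IsOver U (C (MvPolynomial.C c) * F) := fun s j hj => by
  rw [Polynomial.coeff_C_mul] at hj
  rcases Finset.mem_union.mp (MvPolynomial.vars_mul _ _ hj) with h | h
  · rw [MvPolynomial.vars_C] at h
    exact absurd h (Finset.notMem_empty j)
  · exact hF s j h

/-- Bookkeeping (ours): `σ ↦ aσ` with `a = C μ` a scalar keeps `F` over `U`. [cite: SerreLocalFields1979, Ch. II §4 Lemma 1] -/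
theorem sigmaScale [DecidableEq ι] {F : (MvPolynomial ι k)[X]} (hF : IsOver U F) (μ : k) :
    IsOver U (sigmaScale (MvPolynomial.C μ) F) := fun s j hj => by
  rw [coeff_sigmaScale, ← map_pow] at hj
  rcases Finset.mem_union.mp (MvPolynomial.vars_mul _ _ hj) with h | h
  · rw [MvPolynomial.vars_C] at h
    exact absurd h (Finset.notMem_empty j)
  · exact hF s j h

/-- A slot of `U` is over `U` (ours). [cite: SerreLocalFields1979, Ch. II §4 Lemma 1] -/
theorem C_X {u : ι} (hu : u ∈ U) : IsOver U (C (MvPolynomial.X u) : (MvPolynomial ι k)[X]) := fun s j hj => by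
  rw [Polynomial.coeff_C] at hj
  split_ifs at hj with hs
  · obtain ⟨d, hd, hjd⟩ := (MvPolynomial.mem_vars_iff_mem_support j).mp hj
    change d ∈ (MvPolynomial.monomial (Finsupp.single u 1) (1 : k)).support at hd
    rw [Finset.mem_singleton.mp (MvPolynomial.support_monomial_subset hd)] at hjd
    rw [Finset.mem_singleton.mp (Finsupp.support_single_subset hjd)]
    exact hu
  · rw [MvPolynomial.vars_0] at hj
    exact absurd hj (Finset.notMem_empty j)

/-- Scalars are over `U` (ours). [cite: SerreLocalFields1979, Ch. II §4 Lemma 1] -/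
theorem C_C (c : k) : IsOver U (C (MvPolynomial.C c) : (MvPolynomial ι k)[X]) := fun s j hj => by
  rw [Polynomial.coeff_C] at hj
  split_ifs at hj
  · rw [MvPolynomial.vars_C] at hj
    exact absurd hj (Finset.notMem_empty j)
  · rw [MvPolynomial.vars_0] at hj
    exact absurd hj (Finset.notMem_empty j)

/-- `σ` is over `U` (ours). [cite: SerreLocalFields1979, Ch. II §4 Lemma 1] -/
theorem X : IsOver U (Polynomial.X : (MvPolynomial ι k)[X]) := fun s j hj => by
  rw [Polynomial.coeff_X] at hj
  split_ifs at hj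
  · rw [← MvPolynomial.C_1, MvPolynomial.vars_C] at hj
    exact absurd hj (Finset.notMem_empty j)
  · rw [MvPolynomial.vars_0] at hj
    exact absurd hj (Finset.notMem_empty j)

/-- Bookkeeping (ours): products stay over `U`. [cite: SerreLocalFields1979, Ch. II §4 Lemma 1] -/
theorem mul [DecidableEq ι] {F G : (MvPolynomial ι k)[X]} (hF : IsOver U F) (hG : IsOver U G) : IsOver U (F * G) :=
  fun s j hj => by
    rw [Polynomial.coeff_mul] at hj
    obtain ⟨x, -, hx⟩ := Finset.mem_biUnion.mp (MvPolynomial.vars_sum_subset _ _ hj)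
    rcases Finset.mem_union.mp (MvPolynomial.vars_mul _ _ hx) with h | h
    · exact hF _ j h
    · exact hG _ j h

end IsOver

/-- **Pointwise fixing of `k[ε_U][σ]`** (ours): a ring endomorphism of `k[ε][σ]` fixing the scalars, `σ` and the slots of `U`
fixes every element over `U`. [cite: SerreLocalFields1979, Ch. II §4 Lemma 1] -/
theorem apply_eq_self_of_isOver {U : Set ι} (Φ : (MvPolynomial ι k)[X] →+* (MvPolynomial ι k)[X])
    (hC : ∀ c : k, Φ (C (MvPolynomial.C c)) = C (MvPolynomial.C c)) (hX : Φ Polynomial.X = Polynomial.X)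
    (hU : ∀ u ∈ U, Φ (C (MvPolynomial.X u)) = C (MvPolynomial.X u)) {F : (MvPolynomial ι k)[X]} (hF : IsOver U F) :
    Φ F = F := by
  have hq : ∀ q : MvPolynomial ι k, (∀ j ∈ q.vars, j ∈ U) → Φ (C q) = C q := by
    intro q hq
    have key := MvPolynomial.hom_congr_vars (f₁ := Φ.comp C) (f₂ := (C : MvPolynomial ι k →+* (MvPolynomial ι k)[X]))
      (p₁ := q) (p₂ := q) (by ext c; simp only [RingHom.comp_apply, hC])
      (fun j hj _ => by simp only [RingHom.comp_apply, hU j (hq j hj)]) rfl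
    rwa [RingHom.comp_apply] at key
  conv_rhs => rw [F.as_sum_support_C_mul_X_pow]
  conv_lhs => rw [F.as_sum_support_C_mul_X_pow, map_sum]
  refine Finset.sum_congr rfl fun i _ => ?_
  rw [map_mul, map_pow, hX, hq _ (hF i)]

/-! ## Additive shifts off `U` -/

/-- `Φ` is **the additive shift by `P` off `U`** (ours): it fixes scalars, `σ` and (via `P_u = 0`) the slots of `U`, sends
`ε_x ↦ ε_x + P_x`, and every `P_x` lies in `k[ε_U][σ]`. [cite: SerreLocalFields1979, Ch. II §4 Lemma 1] -/
structure IsShiftBy (U : Set ι) (P : ι → (MvPolynomial ι k)[X]) (Φ : (MvPolynomial ι k)[X] →+* (MvPolynomial ι k)[X]) :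
    Prop where
  /-- scalars fixed -/
  map_C_C : ∀ c : k, Φ (C (MvPolynomial.C c)) = C (MvPolynomial.C c)
  /-- `σ` fixed -/
  map_X : Φ Polynomial.X = Polynomial.X
  /-- slots shifted by `P` -/
  map_CX : ∀ x, Φ (C (MvPolynomial.X x)) = C (MvPolynomial.X x) + P x
  /-- no shift on `U` -/
  eq_zero_of_mem : ∀ u ∈ U, P u = 0
  /-- shifts over `U` -/
  isOver : ∀ x, IsOver U (P x)

namespace IsShiftBy

variable {U : Set ι} {P Q : ι → (MvPolynomial ι k)[X]} {Φ Ψ : (MvPolynomial ι k)[X] →+* (MvPolynomial ι k)[X]}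

/-- Slots of `U` are fixed (ours). [cite: SerreLocalFields1979, Ch. II §4 Lemma 1] -/
theorem map_CX_of_mem (h : IsShiftBy U P Φ) {u : ι} (hu : u ∈ U) : Φ (C (MvPolynomial.X u)) = C (MvPolynomial.X u) := by
  rw [h.map_CX, h.eq_zero_of_mem u hu, add_zero]

/-- `Φ_P` fixes `k[ε_U][σ]` pointwise (ours; the reason for the composition law). [cite: SerreLocalFields1979, Ch. II §4 Lemma 1] -/
theorem apply_eq_self (h : IsShiftBy U P Φ) {F : (MvPolynomial ι k)[X]} (hF : IsOver U F) : Φ F = F :=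
  apply_eq_self_of_isOver Φ h.map_C_C h.map_X (fun _ hu => h.map_CX_of_mem hu) hF

/-- **LEMMA G, composition law** (ours): `Φ_P ∘ Φ_Q = Φ_{P+Q}`. [cite: SerreLocalFields1979, Ch. II §4 Lemma 1] -/
theorem comp [DecidableEq ι] (hΦ : IsShiftBy U P Φ) (hΨ : IsShiftBy U Q Ψ) : IsShiftBy U (P + Q) (Φ.comp Ψ) where
  map_C_C c := by rw [RingHom.comp_apply, hΨ.map_C_C, hΦ.map_C_C]
  map_X := by rw [RingHom.comp_apply, hΨ.map_X, hΦ.map_X]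
  map_CX x := by
    rw [RingHom.comp_apply, hΨ.map_CX, map_add, hΦ.map_CX, hΦ.apply_eq_self (hΨ.isOver x), Pi.add_apply, add_assoc]
  eq_zero_of_mem u hu := by rw [Pi.add_apply, hΦ.eq_zero_of_mem u hu, hΨ.eq_zero_of_mem u hu, add_zero]
  isOver x := (hΦ.isOver x).add (hΨ.isOver x)

/-- **LEMMA G, uniqueness** (ours): the shift by `P` is determined by `P`. [cite: SerreLocalFields1979, Ch. II §4 Lemma 1] -/
theorem unique (h₁ : IsShiftBy U P Φ) (h₂ : IsShiftBy U P Ψ) : Φ = Ψ := by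
  refine Polynomial.ringHom_ext (fun a => ?_) (by rw [h₁.map_X, h₂.map_X])
  have key : Φ.comp C = Ψ.comp C :=
    MvPolynomial.ringHom_ext (fun c => by rw [RingHom.comp_apply, RingHom.comp_apply, h₁.map_C_C, h₂.map_C_C])
      fun x => by rw [RingHom.comp_apply, RingHom.comp_apply, h₁.map_CX, h₂.map_CX]
  simpa only [RingHom.comp_apply] using RingHom.congr_fun key a

end IsShiftBy

/-- The identity is the shift by `0` (ours). [cite: SerreLocalFields1979, Ch. II §4 Lemma 1] -/
theorem isShiftBy_id (U : Set ι) : IsShiftBy U (0 : ι → (MvPolynomial ι k)[X]) (RingHom.id _) where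
  map_C_C _ := rfl
  map_X := rfl
  map_CX x := by rw [RingHom.id_apply, Pi.zero_apply, add_zero]
  eq_zero_of_mem _ _ := rfl
  isOver _ := IsOver.zero

/-- **LEMMA G, unit** (ours): a shift by `0` is the identity. [cite: SerreLocalFields1979, Ch. II §4 Lemma 1] -/
theorem IsShiftBy.eq_id {U : Set ι} {Φ : (MvPolynomial ι k)[X] →+* (MvPolynomial ι k)[X]} (h : IsShiftBy U 0 Φ) :
    Φ = RingHom.id _ :=
  h.unique (isShiftBy_id U)

/-! ## The construction `Φ_P` -/

/-- `Φ_P := (scalars fixed, σ ↦ σ, ε_x ↦ ε_x + P_x)` (construction, ours). [cite: SerreLocalFields1979, Ch. II §4 Lemma 1] -/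
noncomputable def shiftHom (P : ι → (MvPolynomial ι k)[X]) : (MvPolynomial ι k)[X] →+* (MvPolynomial ι k)[X] :=
  eval₂RingHom (MvPolynomial.eval₂Hom (C.comp MvPolynomial.C) fun x => C (MvPolynomial.X x) + P x) Polynomial.X

/-- Plumbing (ours). [cite: SerreLocalFields1979, Ch. II §4 Lemma 1] -/
@[simp] theorem shiftHom_X (P : ι → (MvPolynomial ι k)[X]) : shiftHom P Polynomial.X = Polynomial.X := by
  rw [shiftHom, coe_eval₂RingHom, eval₂_X]

/-- Plumbing (ours). [cite: SerreLocalFields1979, Ch. II §4 Lemma 1] -/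
@[simp] theorem shiftHom_C_C (P : ι → (MvPolynomial ι k)[X]) (c : k) :
    shiftHom P (C (MvPolynomial.C c)) = C (MvPolynomial.C c) := by
  rw [shiftHom, coe_eval₂RingHom, eval₂_C, MvPolynomial.eval₂Hom_C, RingHom.comp_apply]

/-- Plumbing (ours). [cite: SerreLocalFields1979, Ch. II §4 Lemma 1] -/
@[simp] theorem shiftHom_C_X (P : ι → (MvPolynomial ι k)[X]) (x : ι) :
    shiftHom P (C (MvPolynomial.X x)) = C (MvPolynomial.X x) + P x := by
  rw [shiftHom, coe_eval₂RingHom, eval₂_C, MvPolynomial.eval₂Hom_X']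

/-- `Φ_P` is the shift by `P` off `U` whenever `P` vanishes on `U` and is over `U` (ours).
[cite: SerreLocalFields1979, Ch. II §4 Lemma 1] -/
theorem isShiftBy_shiftHom {U : Set ι} {P : ι → (MvPolynomial ι k)[X]} (h0 : ∀ u ∈ U, P u = 0) (hover : ∀ x, IsOver U (P x)) :
    IsShiftBy U P (shiftHom P) where
  map_C_C := shiftHom_C_C P
  map_X := shiftHom_X P
  map_CX := shiftHom_C_X P
  eq_zero_of_mem := h0
  isOver := hover

/-- `Φ_0 = id` (ours). [cite: SerreLocalFields1979, Ch. II §4 Lemma 1] -/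
theorem shiftHom_zero : shiftHom (0 : ι → (MvPolynomial ι k)[X]) = RingHom.id _ :=
  (isShiftBy_shiftHom (U := Set.univ) (fun _ _ => rfl) fun _ => IsOver.zero).eq_id

/-- **LEMMA G**: `Φ_{P+Q} = Φ_P ∘ Φ_Q` for shift data over `U` (ours). [cite: SerreLocalFields1979, Ch. II §4 Lemma 1] -/
theorem shiftHom_add [DecidableEq ι] {U : Set ι} {P Q : ι → (MvPolynomial ι k)[X]} (hP0 : ∀ u ∈ U, P u = 0)
    (hP : ∀ x, IsOver U (P x)) (hQ0 : ∀ u ∈ U, Q u = 0) (hQ : ∀ x, IsOver U (Q x)) :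
    shiftHom (P + Q) = (shiftHom P).comp (shiftHom Q) :=
  (isShiftBy_shiftHom (U := U) (P := P + Q) (fun u hu => by rw [Pi.add_apply, hP0 u hu, hQ0 u hu, add_zero])
    fun x => (hP x).add (hQ x)).unique ((isShiftBy_shiftHom hP0 hP).comp (isShiftBy_shiftHom hQ0 hQ))

/-- Shifts over `U` COMMUTE (ours; the group is abelian). [cite: SerreLocalFields1979, Ch. II §4 Lemma 1] -/
theorem shiftHom_comm [DecidableEq ι] {U : Set ι} {P Q : ι → (MvPolynomial ι k)[X]} (hP0 : ∀ u ∈ U, P u = 0)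
    (hP : ∀ x, IsOver U (P x)) (hQ0 : ∀ u ∈ U, Q u = 0) (hQ : ∀ x, IsOver U (Q x)) :
    (shiftHom P).comp (shiftHom Q) = (shiftHom Q).comp (shiftHom P) := by
  rw [← shiftHom_add hP0 hP hQ0 hQ, ← shiftHom_add hQ0 hQ hP0 hP, add_comm]

/-- `Φ_{−P} ∘ Φ_P = id` (ours). [cite: SerreLocalFields1979, Ch. II §4 Lemma 1] -/
theorem shiftHom_neg_comp [DecidableEq ι] {U : Set ι} {P : ι → (MvPolynomial ι k)[X]} (hP0 : ∀ u ∈ U, P u = 0)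
    (hP : ∀ x, IsOver U (P x)) : (shiftHom (-P)).comp (shiftHom P) = RingHom.id _ := by
  rw [← shiftHom_add (U := U) (P := -P) (Q := P) (fun u hu => by rw [Pi.neg_apply, hP0 u hu, neg_zero])
    (fun x => (hP x).neg) hP0 hP, neg_add_cancel, shiftHom_zero]

/-! ## Gradedness -/

section Graded

variable {M : Type*} [AddCommGroup M] {w : ι → M} {ρ : M}

/-- A shift by data of the right total weights is a GRADED endomorphism (ours). [cite: AbramovichTemkinWlodarczyk2024, Thm. 5.3.1 (2)–(3) (p. 1578)] -/
theorem isGradedHom_shiftHom {P : ι → (MvPolynomial ι k)[X]} (hP : ∀ x, IsTW w ρ (w x) (P x)) :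
    IsGradedHom w ρ (shiftHom P) where
  map_C_C := shiftHom_C_C P
  isTW_X := by rw [shiftHom_X]; exact isTW_X
  isTW_CX x := by
    rw [shiftHom_C_X]
    exact (isTW_C (MvPolynomial.isWeightedHomogeneous_X k w x)).add (hP x)

/-- … and a graded ISOTROPY of `G` when it fixes `C G` (ours). [cite: AbramovichTemkinWlodarczyk2024, Thm. 5.3.1 (2)–(3) (p. 1578)] -/
theorem isGradedIso_shiftHom {P : ι → (MvPolynomial ι k)[X]} (hP : ∀ x, IsTW w ρ (w x) (P x)) {G : MvPolynomial ι k}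
    (hG : IsIsotropyOf G (shiftHom P)) : IsGradedIso w ρ G (shiftHom P) :=
  ⟨isGradedHom_shiftHom hP, shiftHom_X P, hG⟩

end Graded

/-! ## LEMMA G: the fixing shifts form an additive subgroup, stable under `σ ↦ μσ` -/

/-- **LEMMA G** (ours): the shift data over `U` whose shift FIXES `G` form an additive subgroup of `ι → k[ε][σ]`.
[cite: SerreLocalFields1979, Ch. II §4 Lemma 1] -/
def fixingShifts [DecidableEq ι] (U : Set ι) (G : MvPolynomial ι k) : AddSubgroup (ι → (MvPolynomial ι k)[X]) where
  carrier := {P | (∀ u ∈ U, P u = 0) ∧ (∀ x, IsOver U (P x)) ∧ IsIsotropyOf G (shiftHom P)}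
  zero_mem' := ⟨fun _ _ => rfl, fun _ => IsOver.zero, by
    change shiftHom (0 : ι → (MvPolynomial ι k)[X]) (C G) = C G
    rw [shiftHom_zero, RingHom.id_apply]⟩
  add_mem' := by
    rintro P Q ⟨hP0, hP, hPG⟩ ⟨hQ0, hQ, hQG⟩
    refine ⟨fun u hu => by rw [Pi.add_apply, hP0 u hu, hQ0 u hu, add_zero], fun x => (hP x).add (hQ x), ?_⟩
    change shiftHom (P + Q) (C G) = C G
    rw [shiftHom_add hP0 hP hQ0 hQ, RingHom.comp_apply, show shiftHom Q (C G) = C G from hQG]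
    exact hPG
  neg_mem' := by
    rintro P ⟨hP0, hP, hPG⟩
    refine ⟨fun u hu => by rw [Pi.neg_apply, hP0 u hu, neg_zero], fun x => (hP x).neg, ?_⟩
    change shiftHom (-P) (C G) = C G
    have h := RingHom.congr_fun (shiftHom_neg_comp hP0 hP) (C G)
    rw [RingHom.comp_apply, RingHom.id_apply, show shiftHom P (C G) = C G from hPG] at h
    exact h

/-- Membership unfolding (ours). [cite: SerreLocalFields1979, Ch. II §4 Lemma 1] -/
theorem mem_fixingShifts_iff [DecidableEq ι] {U : Set ι} {G : MvPolynomial ι k} {P : ι → (MvPolynomial ι k)[X]} :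
    P ∈ fixingShifts U G ↔ (∀ u ∈ U, P u = 0) ∧ (∀ x, IsOver U (P x)) ∧ IsIsotropyOf G (shiftHom P) :=
  Iff.rfl

/-! ## Base change `σ ↦ μσ` -/

section Rescale

variable [DecidableEq ι] {U : Set ι} {P : ι → (MvPolynomial ι k)[X]} {Φ : (MvPolynomial ι k)[X] →+* (MvPolynomial ι k)[X]}

/-- `(Φ_P)_{μσ}` is the shift by `P(μσ, ε)` (ours). [cite: SerreLocalFields1979, Ch. II §4 Lemma 1] -/
theorem IsShiftBy.rescaleHom (h : IsShiftBy U P Φ) (μ : k) :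
    IsShiftBy U (fun x => sigmaScale (MvPolynomial.C μ) (P x)) (rescaleHom (MvPolynomial.C μ) Φ) where
  map_C_C c := by rw [rescaleHom_C, h.map_C_C, sigmaScale_C]
  map_X := rescaleHom_X _ _
  map_CX x := by rw [rescaleHom_C, h.map_CX, map_add, sigmaScale_C]
  eq_zero_of_mem u hu := by simp only [h.eq_zero_of_mem u hu, map_zero]
  isOver x := (h.isOver x).sigmaScale μ

/-- `Φ_{P(μσ)} = (Φ_P)_{μσ}` (ours). [cite: SerreLocalFields1979, Ch. II §4 Lemma 1] -/
theorem shiftHom_rescale (hP0 : ∀ u ∈ U, P u = 0) (hP : ∀ x, IsOver U (P x)) (μ : k) :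
    shiftHom (fun x => sigmaScale (MvPolynomial.C μ) (P x)) = rescaleHom (MvPolynomial.C μ) (shiftHom P) :=
  (isShiftBy_shiftHom (U := U) (P := fun x => sigmaScale (MvPolynomial.C μ) (P x))
      (fun u hu => by simp only [hP0 u hu, map_zero]) fun x => (hP x).sigmaScale μ).unique
    ((isShiftBy_shiftHom hP0 hP).rescaleHom μ)

/-- **LEMMA G, base change** (ours): the subgroup of fixing shifts is stable under `P ↦ P(μσ, ε)` — because `G` is `σ`-free
(`isIsotropyOf_rescaleHom`). [cite: SerreLocalFields1979, Ch. II §4 Lemma 1] -/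
theorem rescale_mem_fixingShifts {G : MvPolynomial ι k} (hPG : P ∈ fixingShifts U G) (μ : k) :
    (fun x => sigmaScale (MvPolynomial.C μ) (P x)) ∈ fixingShifts U G := by
  obtain ⟨hP0, hP, hG⟩ := mem_fixingShifts_iff.mp hPG
  refine mem_fixingShifts_iff.mpr ⟨fun u hu => by simp only [hP0 u hu, map_zero], fun x => (hP x).sigmaScale μ, ?_⟩
  rw [shiftHom_rescale hP0 hP μ]
  exact isIsotropyOf_rescaleHom hG _

end Rescale

/-! ## A worked instance -/

/-- Smoke test (ours): two slots, `U = {0}`, the shift `ε₁ ↦ ε₁ + σ·ε₀` fixes `G = ε₀`, so its data lie in `fixingShifts {0} ε₀`.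
[cite: SerreLocalFields1979, Ch. II §4 Lemma 1] -/
example : (fun x : Fin 2 => (if x = 1 then C (MvPolynomial.X 0) * Polynomial.X else 0 : (MvPolynomial (Fin 2) ℚ)[X]))
    ∈ fixingShifts ({0} : Set (Fin 2)) (MvPolynomial.X 0 : MvPolynomial (Fin 2) ℚ) := by
  refine mem_fixingShifts_iff.mpr ⟨fun u hu => ?_, fun x => ?_, ?_⟩
  · rw [Set.mem_singleton_iff] at hu
    subst hu
    rfl
  · by_cases hx : x = 1
    · simp only [hx, if_true]
      refine IsOver.mul ?_ IsOver.X
      exact IsOver.C_X (Set.mem_singleton _)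
    · simp only [hx, if_false]
      exact IsOver.zero
  · change shiftHom _ (C (MvPolynomial.X 0)) = C (MvPolynomial.X 0)
    rw [shiftHom_C_X]
    simp

end AdditiveShift

end Literature.AlgebraicGeometry.Resolution.WeightedBlowup
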